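import Mathlib
import Literature.Computability.AlgebraicComplexity.DeterminantalConormalBoundMixed

/-!
# Crux `DetQP.DetqpSuperquadratic` (stmt-ValiantsHypothesis-0318), line `sectional-class-ladder`
# (skeleton v2, ND route) — helper for stub `stub_polarCountND`: multihomogeneity and
# non-triviality of Sheshadri's kernel-incidence system

Stub `stub_polarCountND` re-runs the tree's `ncard_polarSet_le_conormalBezout_of_pencil`
(`Literature/Computability/AlgebraicComplexity/DeterminantalConormalBoundMixed.lean`,
arXiv:2606.13628 §3.1: the kernel-incidence system on `ℙ^N × ℙ^{m-1} × ℙ^{m-1}` counted by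
the multigraded refined Bézout number) for finite sets of NON-DEGENERATE polar points; to keep
every file of the proof below the tree's size limit the facts about the explicit system
`Q = (chart, Â(x)v, (uᵀÂ(x))Λ, pencil)` in the variables `τ = (x₀ ⊔ σ) ⊔ (u ⊔ v)` that do
not depend on the counted points are isolated here, with the system passed as data `(phat, Ahat,
wp, Q)` together with its defining equations (exactly the `set … with` equations of the
assembly):
* `isWeightedHomogeneous_kernelSystem` — every equation is multihomogeneous for the three blocks
  (`x ↦ 0`, `v ↦ 1`, `u ↦ 2`) of multidegrees `e₀, e₀ + e₁, e₀ + e₂, e₁ + e₂`;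
* `kernelSystem_ne_zero` — every equation is a non-zero polynomial, given that no row of `A`
  vanishes, no column of `Â Λ` vanishes and the `N − 2` pencil equations have a non-zero
  coefficient.
Both proofs are the corresponding steps of the tree proof, verbatim up to the packaging.
References: K. Sheshadri, arXiv:2606.13628 (2026), §3.1 [Sheshadri2026Border]; W. Fulton,
*Intersection Theory*, 2nd ed., 1998, Example 12.3.1 [Fulton1998].
-/

noncomputable section

-- `Summit.ValiantsHypothesis.ValiantsHypothesis.…` is the tree's mandated single-conjunct layout
-- (Sub = Summit), so the duplicated namespace component is intended.
set_option linter.dupNamespace false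

namespace Summit.ValiantsHypothesis.ValiantsHypothesis.Theorems.DetQPDetqpSuperquadratic

open MvPolynomial Matrix Finset
open Literature.Computability.AlgebraicComplexity
open Literature.Computability.AlgebraicComplexity.DeterminantalConormal
open Literature.RingTheory.MvPolynomial

/-- **Multihomogeneity of the kernel-incidence system** (arXiv:2606.13628 §3.1 Step 4): with the
blocks `x₀, x ↦ 0`, `v ↦ 1`, `u ↦ 2`, the chart equation has multidegree `e₀`, the right
kernel equations `e₀ + e₁`, the reduced left kernel equations `e₀ + e₂` and the pencil equations
`e₁ + e₂`. [cite: Sheshadri2026Border, §3.1 Step 4] -/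
theorem isWeightedHomogeneous_kernelSystem {σ : Type} [Fintype σ] [DecidableEq σ] {m : ℕ}
    (A : Matrix (Fin (m + 1)) (Fin (m + 1)) (MvPolynomial σ ℂ))
    (a b c : σ → ℂ) {j₀ k₀ : σ} (Λ : Matrix (Fin (m + 1)) (Fin m) ℂ)
    (x0 : ((Unit ⊕ σ) ⊕ (Fin (m + 1) ⊕ Fin (m + 1))))
    (xv : σ → ((Unit ⊕ σ) ⊕ (Fin (m + 1) ⊕ Fin (m + 1))))
    (uu vv : Fin (m + 1) → ((Unit ⊕ σ) ⊕ (Fin (m + 1) ⊕ Fin (m + 1))))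
    (phat : MvPolynomial σ ℂ → MvPolynomial ((Unit ⊕ σ) ⊕ (Fin (m + 1) ⊕ Fin (m + 1))) ℂ)
    (hphat : phat = fun p =>
      C (coeff 0 p) * X x0 + ∑ i, C (coeff (Finsupp.single i 1) p) * X (xv i))
    (Ahat : Matrix (Fin (m + 1)) (Fin (m + 1))
      (MvPolynomial ((Unit ⊕ σ) ⊕ (Fin (m + 1) ⊕ Fin (m + 1))) ℂ))
    (hAhat : Ahat = A.map phat)
    (wp : σ → MvPolynomial ((Unit ⊕ σ) ⊕ (Fin (m + 1) ⊕ Fin (m + 1))) ℂ)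
    (hwp : wp = fun i =>
      ∑ k, ∑ l, C (coeff (Finsupp.single i 1) (A k l)) * X (uu k) * X (vv l))
    (Q : ((Unit ⊕ Fin (m + 1)) ⊕ (Fin m ⊕ {i : σ // i ≠ j₀ ∧ i ≠ k₀})) →
      MvPolynomial ((Unit ⊕ σ) ⊕ (Fin (m + 1) ⊕ Fin (m + 1))) ℂ)
    (hQ : Q = Sum.elim
      (Sum.elim (fun _ => X x0 - ∑ i, C (c i) * X (xv i)) (fun k => ∑ l, Ahat k l * X (vv l)))
      (Sum.elim
        (fun j => ∑ k, X (uu k) * (Ahat * Λ.map (fun r : ℂ =>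
          (C r : MvPolynomial ((Unit ⊕ σ) ⊕ (Fin (m + 1) ⊕ Fin (m + 1))) ℂ))) k j)
        (fun i => C (a j₀ * b k₀ - a k₀ * b j₀) * wp i.1 -
          (C (b k₀) * wp j₀ - C (b j₀) * wp k₀) * C (a i.1) -
          (C (a j₀) * wp k₀ - C (a k₀) * wp j₀) * C (b i.1))))
    (blk : ((Unit ⊕ σ) ⊕ (Fin (m + 1) ⊕ Fin (m + 1))) → Fin 3) (hb0 : blk x0 = 0)
    (hbx : ∀ i, blk (xv i) = 0) (hbu : ∀ k, blk (uu k) = 2) (hbv : ∀ l, blk (vv l) = 1)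
    (δ : ((Unit ⊕ Fin (m + 1)) ⊕ (Fin m ⊕ {i : σ // i ≠ j₀ ∧ i ≠ k₀})) → Fin 3 → ℕ)
    (hδdef : δ = Sum.elim
      (Sum.elim (fun _ => Pi.single 0 1) (fun _ => Pi.single 0 1 + Pi.single 1 1))
      (Sum.elim (fun _ => Pi.single 0 1 + Pi.single 2 1)
        (fun _ => Pi.single 1 1 + Pi.single 2 1))) :
    ∀ j, (Q j).IsWeightedHomogeneous (fun t => (Pi.single (blk t) 1 : Fin 3 → ℕ)) (δ j) := by
  set wt : ((Unit ⊕ σ) ⊕ (Fin (m + 1) ⊕ Fin (m + 1))) → Fin 3 → ℕ :=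
    fun t => Pi.single (blk t) 1 with hwt
  have hX0 : IsWeightedHomogeneous wt (X x0 : MvPolynomial _ ℂ)
      (Pi.single 0 1) := by
    simpa [hwt, hb0] using isWeightedHomogeneous_X (R := ℂ) wt x0
  have hXv : ∀ i, IsWeightedHomogeneous wt (X (xv i) : MvPolynomial _ ℂ)
      (Pi.single 0 1) := fun i => by
    simpa [hwt, hbx] using isWeightedHomogeneous_X (R := ℂ) wt (xv i)
  have hXu : ∀ k, IsWeightedHomogeneous wt (X (uu k) : MvPolynomial _ ℂ)
      (Pi.single 2 1) := fun k => by
    simpa [hwt, hbu] using isWeightedHomogeneous_X (R := ℂ) wt (uu k)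
  have hXvv : ∀ l, IsWeightedHomogeneous wt (X (vv l) : MvPolynomial _ ℂ)
      (Pi.single 1 1) := fun l => by
    simpa [hwt, hbv] using isWeightedHomogeneous_X (R := ℂ) wt (vv l)
  have hCmul : ∀ (r : ℂ) {φ : MvPolynomial _ ℂ} {n : Fin 3 → ℕ},
      IsWeightedHomogeneous wt φ n → IsWeightedHomogeneous wt (C r * φ) n :=
    fun r φ n h => h.C_mul r
  have hmulC : ∀ (r : ℂ) {φ : MvPolynomial _ ℂ} {n : Fin 3 → ℕ},
      IsWeightedHomogeneous wt φ n → IsWeightedHomogeneous wt (φ * C r) n :=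
    fun r φ n h => by simpa using h.mul (isWeightedHomogeneous_C wt r)
  have hsub : ∀ {φ ψ : MvPolynomial ((Unit ⊕ σ) ⊕ (Fin (m + 1) ⊕ Fin (m + 1))) ℂ}
      {n : Fin 3 → ℕ},
      IsWeightedHomogeneous wt φ n → IsWeightedHomogeneous wt ψ n →
        IsWeightedHomogeneous wt (φ - ψ) n :=
    fun {φ ψ n} h1 h2 => (weightedHomogeneousSubmodule ℂ wt n).sub_mem h1 h2
  have hphatw : ∀ p, IsWeightedHomogeneous wt (phat p) (Pi.single 0 1) := fun p => by
    rw [hphat]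
    exact (hCmul _ hX0).add (IsWeightedHomogeneous.sum _ _ _ fun i _ => hCmul _ (hXv i))
  have hAhatw : ∀ k l, IsWeightedHomogeneous wt (Ahat k l) (Pi.single 0 1) := fun k l => by
    rw [hAhat, Matrix.map_apply]; exact hphatw _
  have hwpw : ∀ i, IsWeightedHomogeneous wt (wp i) (Pi.single 1 1 + Pi.single 2 1) := by
    intro i
    rw [hwp]
    refine IsWeightedHomogeneous.sum _ _ _ fun k _ =>
      IsWeightedHomogeneous.sum _ _ _ fun l _ => ?_
    have h := (hCmul (coeff (Finsupp.single i 1) (A k l)) (hXu k)).mul (hXvv l)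
    rwa [add_comm (Pi.single 2 1 : Fin 3 → ℕ) (Pi.single 1 1)] at h
  intro j
  rcases j with ((_ | k) | (j | i))
  · simp only [hQ, hδdef, Sum.elim_inl]
    exact hsub hX0 (IsWeightedHomogeneous.sum _ _ _ fun i _ => hCmul _ (hXv i))
  · simp only [hQ, hδdef, Sum.elim_inl, Sum.elim_inr]
    exact IsWeightedHomogeneous.sum _ _ _ fun l _ => (hAhatw k l).mul (hXvv l)
  · simp only [hQ, hδdef, Sum.elim_inl, Sum.elim_inr]
    refine IsWeightedHomogeneous.sum _ _ _ fun k _ => ?_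
    have hentry : IsWeightedHomogeneous wt ((Ahat * Λ.map fun r : ℂ =>
        (C r : MvPolynomial ((Unit ⊕ σ) ⊕ (Fin (m + 1) ⊕ Fin (m + 1))) ℂ)) k j)
        (Pi.single 0 1) := by
      rw [Matrix.mul_apply]
      exact IsWeightedHomogeneous.sum _ _ _ fun l _ => by
        rw [Matrix.map_apply]; exact hmulC _ (hAhatw k l)
    have h := (hXu k).mul hentry
    rwa [add_comm (Pi.single 2 1 : Fin 3 → ℕ) (Pi.single 0 1)] at h
  · simp only [hQ, hδdef, Sum.elim_inr]
    exact hsub (hsub (hCmul _ (hwpw _)) (hmulC _ (hsub (hCmul _ (hwpw _)) (hCmul _ (hwpw _)))))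
      (hmulC _ (hsub (hCmul _ (hwpw _)) (hCmul _ (hwpw _))))

/-- **Non-triviality of the kernel-incidence system** (arXiv:2606.13628 §3.1 Steps 3–4): if no
row of `A` vanishes, no column of `Â Λ` vanishes identically and each of the `N − 2` pencil
equations has a non-zero coefficient, then every equation of the system is a non-zero
polynomial (each is tested at an explicit point). [cite: Sheshadri2026Border, §3.1 Steps 3–4] -/
theorem kernelSystem_ne_zero {σ : Type} [Fintype σ] [DecidableEq σ] {m : ℕ}
    (A : Matrix (Fin (m + 1)) (Fin (m + 1)) (MvPolynomial σ ℂ))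
    (hA1 : ∀ k l, (A k l).totalDegree ≤ 1) (hrowA : ∀ k, ∃ l, A k l ≠ 0)
    (a b c : σ → ℂ) {j₀ k₀ : σ} (Λ : Matrix (Fin (m + 1)) (Fin m) ℂ)
    (x0 : ((Unit ⊕ σ) ⊕ (Fin (m + 1) ⊕ Fin (m + 1))))
    (xv : σ → ((Unit ⊕ σ) ⊕ (Fin (m + 1) ⊕ Fin (m + 1))))
    (uu vv : Fin (m + 1) → ((Unit ⊕ σ) ⊕ (Fin (m + 1) ⊕ Fin (m + 1))))
    (hx0 : x0 = Sum.inl (Sum.inl ())) (hxv : xv = fun i => Sum.inl (Sum.inr i))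
    (huu : uu = fun k => Sum.inr (Sum.inl k)) (hvv : vv = fun l => Sum.inr (Sum.inr l))
    (phat : MvPolynomial σ ℂ → MvPolynomial ((Unit ⊕ σ) ⊕ (Fin (m + 1) ⊕ Fin (m + 1))) ℂ)
    (hphat : phat = fun p =>
      C (coeff 0 p) * X x0 + ∑ i, C (coeff (Finsupp.single i 1) p) * X (xv i))
    (Ahat : Matrix (Fin (m + 1)) (Fin (m + 1))
      (MvPolynomial ((Unit ⊕ σ) ⊕ (Fin (m + 1) ⊕ Fin (m + 1))) ℂ))
    (hAhat : Ahat = A.map phat)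
    (wp : σ → MvPolynomial ((Unit ⊕ σ) ⊕ (Fin (m + 1) ⊕ Fin (m + 1))) ℂ)
    (hwp : wp = fun i =>
      ∑ k, ∑ l, C (coeff (Finsupp.single i 1) (A k l)) * X (uu k) * X (vv l))
    (Q : ((Unit ⊕ Fin (m + 1)) ⊕ (Fin m ⊕ {i : σ // i ≠ j₀ ∧ i ≠ k₀})) →
      MvPolynomial ((Unit ⊕ σ) ⊕ (Fin (m + 1) ⊕ Fin (m + 1))) ℂ)
    (hQ : Q = Sum.elim
      (Sum.elim (fun _ => X x0 - ∑ i, C (c i) * X (xv i)) (fun k => ∑ l, Ahat k l * X (vv l)))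
      (Sum.elim
        (fun j => ∑ k, X (uu k) * (Ahat * Λ.map (fun r : ℂ =>
          (C r : MvPolynomial ((Unit ⊕ σ) ⊕ (Fin (m + 1) ⊕ Fin (m + 1))) ℂ))) k j)
        (fun i => C (a j₀ * b k₀ - a k₀ * b j₀) * wp i.1 -
          (C (b k₀) * wp j₀ - C (b j₀) * wp k₀) * C (a i.1) -
          (C (a j₀) * wp k₀ - C (a k₀) * wp j₀) * C (b i.1))))
    (hΛcol : ∀ j : Fin m, ∃ k, (Ahat * Λ.map (fun r : ℂ =>
      (C r : MvPolynomial ((Unit ⊕ σ) ⊕ (Fin (m + 1) ⊕ Fin (m + 1))) ℂ))) k j ≠ 0)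
    (hM : ∀ i, i ≠ j₀ → i ≠ k₀ → ∃ k l,
      (a j₀ * b k₀ - a k₀ * b j₀) * coeff (Finsupp.single i 1) (A k l) -
        (b k₀ * coeff (Finsupp.single j₀ 1) (A k l) -
            b j₀ * coeff (Finsupp.single k₀ 1) (A k l)) * a i -
        (a j₀ * coeff (Finsupp.single k₀ 1) (A k l) -
            a k₀ * coeff (Finsupp.single j₀ 1) (A k l)) * b i ≠ 0) :
    ∀ j, Q j ≠ 0 := by
  classical
  have hphat_eval : ∀ p (y : ((Unit ⊕ σ) ⊕ (Fin (m + 1) ⊕ Fin (m + 1))) → ℂ),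
      eval y (phat p) = y x0 * coeff 0 p + ∑ i, y (xv i) * coeff (Finsupp.single i 1) p := by
    intro p y
    simp only [hphat, map_add, map_sum, map_mul, eval_C, eval_X]
    rw [mul_comm]
    exact congrArg _ (Finset.sum_congr rfl fun i _ => mul_comm _ _)
  have hphat_ne : ∀ p, p.totalDegree ≤ 1 → p ≠ 0 → phat p ≠ 0 := by
    intro p hp hp0 h0
    apply hp0
    rw [eq_zero_iff_of_totalDegree_le_one hp]
    constructor
    · have h1 := congrArg (eval (fun t => if t = x0 then (1 : ℂ) else 0)) h0
      rw [hphat_eval, map_zero] at h1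
      simpa [hxv, hx0] using h1
    · intro i
      have h1 := congrArg (eval (fun t => if t = xv i then (1 : ℂ) else 0)) h0
      rw [hphat_eval, map_zero] at h1
      simp only [hxv, hx0, reduceCtorEq, Sum.inl.injEq, if_false, zero_mul, zero_add,
        Sum.inr.injEq] at h1
      rw [Finset.sum_eq_single i (fun j _ hj => by rw [if_neg hj, zero_mul])
        (fun h => absurd (Finset.mem_univ i) h), if_pos rfl, one_mul] at h1
      exact h1
  have heval_w : ∀ (y : ((Unit ⊕ σ) ⊕ (Fin (m + 1) ⊕ Fin (m + 1))) → ℂ) i, eval y (wp i) =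
      (fun k => y (uu k)) ⬝ᵥ
        (A.map (fun p => coeff (Finsupp.single i 1) p) *ᵥ fun l => y (vv l)) := by
    intro y i
    simp only [hwp, map_sum, map_mul, eval_C, eval_X, dotProduct, mulVec, Matrix.map_apply,
      Finset.mul_sum]
    refine Finset.sum_congr rfl fun k _ => Finset.sum_congr rfl fun l _ => ?_
    ring
  have heval_chart : ∀ y : ((Unit ⊕ σ) ⊕ (Fin (m + 1) ⊕ Fin (m + 1))) → ℂ,
      eval y (Q (Sum.inl (Sum.inl ()))) = y x0 - ∑ i, c i * y (xv i) := by
    intro y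
    simp [hQ]
  have heval_row : ∀ (y : ((Unit ⊕ σ) ⊕ (Fin (m + 1) ⊕ Fin (m + 1))) → ℂ) k,
      eval y (Q (Sum.inl (Sum.inr k))) = (Ahat.map (eval y) *ᵥ fun l => y (vv l)) k := by
    intro y k
    simp [hQ, mulVec, dotProduct]
  have heval_pencil : ∀ (y : ((Unit ⊕ σ) ⊕ (Fin (m + 1) ⊕ Fin (m + 1))) → ℂ)
      (i : {i : σ // i ≠ j₀ ∧ i ≠ k₀}), eval y (Q (Sum.inr (Sum.inr i))) =
      (a j₀ * b k₀ - a k₀ * b j₀) * eval y (wp i.1) -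
        (b k₀ * eval y (wp j₀) - b j₀ * eval y (wp k₀)) * a i.1 -
        (a j₀ * eval y (wp k₀) - a k₀ * eval y (wp j₀)) * b i.1 := by
    intro y i
    simp [hQ]
  intro j
  rcases j with ((_ | k) | (j | i))
  · intro h
    have h1 := congrArg (eval (fun t => if t = x0 then (1 : ℂ) else 0)) h
    rw [heval_chart, map_zero] at h1
    simp [hx0, hxv] at h1
  · obtain ⟨l, hl⟩ := hrowA k
    have hne : Ahat k l ≠ 0 := by
      rw [hAhat, Matrix.map_apply]; exact hphat_ne _ (hA1 k l) hl
    obtain ⟨ξ, hξ⟩ : ∃ ξ : ((Unit ⊕ σ) ⊕ (Fin (m + 1) ⊕ Fin (m + 1))) → ℂ,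
        eval ξ (Ahat k l) ≠ 0 := by
      by_contra h0
      push Not at h0
      exact hne (MvPolynomial.funext fun ξ => by rw [h0 ξ, map_zero])
    intro h
    set y : ((Unit ⊕ σ) ⊕ (Fin (m + 1) ⊕ Fin (m + 1))) → ℂ :=
      Sum.elim (fun s => ξ (Sum.inl s)) (Sum.elim (fun _ => 0) (fun l' => if l' = l then 1 else 0))
      with hy
    have h1 := congrArg (eval y) h
    rw [heval_row, map_zero] at h1
    simp only [mulVec, dotProduct, Matrix.map_apply] at h1
    rw [Finset.sum_eq_single l (fun l' _ hl' => by simp [hy, hvv, hl'])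
      (fun h => absurd (Finset.mem_univ l) h)] at h1
    have hyl : y (vv l) = 1 := by simp [hy, hvv]
    rw [hyl, mul_one] at h1
    apply hξ
    rw [← h1, hAhat, Matrix.map_apply, hphat_eval, hphat_eval]
    simp [hy, hx0, hxv]
  · obtain ⟨k, hk⟩ := hΛcol j
    obtain ⟨ξ, hξ⟩ : ∃ ξ : ((Unit ⊕ σ) ⊕ (Fin (m + 1) ⊕ Fin (m + 1))) → ℂ,
        eval ξ ((Ahat * Λ.map fun r : ℂ =>
          (C r : MvPolynomial ((Unit ⊕ σ) ⊕ (Fin (m + 1) ⊕ Fin (m + 1))) ℂ)) k j) ≠ 0 := by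
      by_contra h0
      push Not at h0
      exact hk (MvPolynomial.funext fun ξ => by rw [h0 ξ, map_zero])
    intro h
    set y : ((Unit ⊕ σ) ⊕ (Fin (m + 1) ⊕ Fin (m + 1))) → ℂ :=
      Sum.elim (fun s => ξ (Sum.inl s)) (Sum.elim (fun k' => if k' = k then 1 else 0) (fun _ => 0))
      with hy
    have h1 := congrArg (eval y) h
    rw [map_zero] at h1
    have h2 : eval y (Q (Sum.inr (Sum.inl j))) =
        ∑ k', y (uu k') * eval y ((Ahat * Λ.map fun r : ℂ =>
          (C r : MvPolynomial ((Unit ⊕ σ) ⊕ (Fin (m + 1) ⊕ Fin (m + 1))) ℂ)) k' j) := by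
      simp only [hQ, Sum.elim_inr, Sum.elim_inl, map_sum, map_mul, eval_X]
    rw [h2, Finset.sum_eq_single k (fun k' _ hk' => by simp [hy, huu, hk'])
      (fun h => absurd (Finset.mem_univ k) h)] at h1
    have hyk : y (uu k) = 1 := by simp [hy, huu]
    rw [hyk, one_mul] at h1
    apply hξ
    rw [← h1]
    simp only [Matrix.mul_apply, Matrix.map_apply, map_sum, map_mul, eval_C, hAhat, hphat_eval]
    simp [hy, hx0, hxv]
  · obtain ⟨k, l, hkl0⟩ := hM i.1 i.2.1 i.2.2
    intro h
    set y : ((Unit ⊕ σ) ⊕ (Fin (m + 1) ⊕ Fin (m + 1))) → ℂ :=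
      Sum.elim (fun _ => 0) (Sum.elim (fun k' => if k' = k then 1 else 0)
        (fun l' => if l' = l then 1 else 0)) with hy
    have h1 := congrArg (eval y) h
    rw [heval_pencil, map_zero] at h1
    have hW : ∀ i', eval y (wp i') = coeff (Finsupp.single i' 1) (A k l) := by
      intro i'
      rw [heval_w]
      have e1 : (fun k' => y (uu k')) = Pi.single k 1 := by
        funext k'; simp [hy, huu, Pi.single_apply]
      have e2 : (fun l' => y (vv l')) = Pi.single l 1 := by
        funext l'; simp [hy, hvv, Pi.single_apply]
      rw [e1, e2, single_dotProduct, one_mul]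
      simp only [mulVec, dotProduct_single, mul_one, Matrix.map_apply]
    rw [hW, hW, hW] at h1
    exact hkl0 h1

end Summit.ValiantsHypothesis.ValiantsHypothesis.Theorems.DetQPDetqpSuperquadratic

end
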